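/-
Copyright (c) 2026 the pub-hodgecm-mathlib formalisation cell (harness21).  Prover seat hodgecm-mathlib-LD1-p02 (g4), organ payer of half-A line LD1
(crux `hLiu418`), brick (Gα-C∞) `ArchLadder`, plate (P4) «ι-step» (dealer LD1-plan (g2) DEALS #10 ∕ #10-bis 2026-09-02; HEAD owner A-p16 (g35)).
THEOREMS ONLY (no definition, no named fact, no `sorry`, no instance, no notation).  `--supports stmt-HodgeConjecture-24832 --as helper`.
-/
import Summits.HodgeConjecture.HodgeConjecture.Theorems.F0LD1ThetaArchLadderIotaStep
import Summits.HodgeConjecture.HodgeConjecture.Theorems.F0LD1ThetaArchDefiniteTransitivity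
import HarnessLib

-- statements over the theta-kernel datum elaborate to very large types; elaborate sequentially (as in the ★ kit lineage)
set_option Elab.async false

/-!
# (Gα-C∞, ι-step, HEAD-FACING FORM) `iotaStep`: inside one `U(W)_∞`-type the Hermite theta classes `[θ_{h_β ⊗ Φ_f}]` with
# `β ↦ β ± (e_{(k₊,v₀)} + e_{(k₋,v₀)})` are reachable through any closed `R`-invariant subspace (line LD1 of crux HLiu418, brick (Gα-C∞)
# `ArchLadder`, plate (P4); pen LD1-p02 (g4); HEAD owner A-p16 (g35))

Cell hodgecm-mathlib, floor 0; namespace `Summit.HodgeConjecture.HodgeConjecture.Cruxes.HLiu418.F0LD1ThetaArchLadderIotaStep` (continued);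
`--supports stmt-HodgeConjecture-24832 --as helper`.  THEOREMS ONLY (no definition, no instance, no notation, no `sorry`).

* **`iotaStep`** — over the data of ★ `F0LD1ThetaArchDefiniteTransitivity` (pin `hpin` of the transport `ιA`, automorphic `ν`): for a real place `v₀`, a
  hyperbolic pair `(k₊, k₋)` of coordinates there (`x_{v₀}(k₊) > 0`, `¬ x_{v₀}(k₋) > 0`) and boosts `u_s ∈ U(σ_{w₀} diag dV)(ℂ)` of that plane for every
  parameter `s` (`hU`, the indefinite twin of ★ `exists_archLocal_entries_eq_of_pos`), every closed `R`-invariant `Q` containing `[θ_{h_β ⊗ Φ_f}]` contains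
  `[θ_{h_{β + e_{(k₊,v₀)} + e_{(k₋,v₀)}} ⊗ Φ_f}]`, and `[θ_{h_{β − e_{(k₊,v₀)} − e_{(k₋,v₀)}} ⊗ Φ_f}]` when `β(k₊,v₀), β(k₋,v₀) > 0`.  PROOF: ★ one boost step
  `thetaClass_follandHermite_mem_of_boostCoeff_ne_zero` at the parameter `s` supplied by the ladder ★ `exists_piCoeff_add∕sub_reindex_hypOp_hermitePi_ne_zero`
  (the derivative at `s = 0` of the Hermite coefficient `c_{β±d}(B_s h_β)` is `−i√((β_{k₊}+1)(β_{k₋}+1)) ≠ 0`, resp. `−i√(β_{k₊} β_{k₋}) ≠ 0`: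
  [Folland1989, §1.7 (1.82), §4.4 Thm. (4.37)]; [KashiwaraVergne1978, §6]); the archimedean type, torus hom, Haar probability, character representation and
  the pinned preimage `k` of `(u_s at w₀)` are discharged as in ★ `F0LD1ThetaArchDefiniteTransitivity`.
No «`≠ 0`» hypothesis on the class is needed (the step is linear).  Nothing printed is discharged; HC_CM is proved only modulo the 7 printed citations
(2 remaining: hLiu418 = stmt-HodgeConjecture-24832, h413 = stmt-HodgeConjecture-24833) until rung 0 closes; count-neutral.

References (prose locators): Folland 1989 §1.7 (1.82), §4.2 (4.24), §4.4 Thm. (4.37); Kashiwara–Vergne 1978 §6; Howe 1989 §3; Konno–Konno 2007 §3.3;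
Bröcker–tom Dieck 1985 III (5.10); Borel–Jacquet 1979 §4.6.
-/

set_option autoImplicit false
set_option linter.dupNamespace false

noncomputable section

open NumberField NumberField.InfinitePlace MeasureTheory IsDedekindDomain
open scoped Matrix ComplexOrder ENNReal TensorProduct SchwartzMap Kronecker Classical ComplexConjugate InnerProductSpace

namespace Summit.HodgeConjecture.HodgeConjecture.Cruxes.HLiu418.F0LD1ThetaArchLadderIotaStep

open _root_.MeasureTheory
open Literature.NumberTheory.Automorphic Literature.NumberTheory.Automorphic.UnitaryGroup
open Literature.NumberTheory.Automorphic.UnitaryGroup.CotangentForms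
open Literature.NumberTheory.Automorphic.IdeleClassGroup
open Literature.NumberTheory.Automorphic.Liu2021
open Literature.NumberTheory.Automorphic.Liu2021.Def411WeilCarriers
open Literature.NumberTheory.Automorphic.Liu2021.Def411WeilCarriersDoubling
open Literature.NumberTheory.Automorphic.Liu2021.CinfThetaTorus
open Literature.NumberTheory.GelbartRogawski1991 Literature.NumberTheory.GelbartRogawski1991.UnitaryDualPair
open Literature.NumberTheory.GelbartRogawski1991.GRConstruction
open Literature.NumberTheory.Weil1964 Literature.NumberTheory.Weil1964.MpS Literature.NumberTheory.Weil1964.UnitaryWeil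
open Literature.RepresentationTheory.Liu2021
open Literature.RepresentationTheory.HeisenbergGroup Literature.Analysis.SegalBargmann
open Literature.RepresentationTheory.KonnoKonno2007 Literature.RepresentationTheory.KonnoKonno2007.RealDualPair
open Literature.RepresentationTheory.CompactGroups
open Summit.HodgeConjecture.HodgeConjecture.Cruxes.HLiu418.F0LD1ThetaTransportKit
open Summit.HodgeConjecture.HodgeConjecture.Cruxes.HLiu418.F0LD2ThetaTensorClasses
open Summit.HodgeConjecture.HodgeConjecture.Cruxes.HLiu418.F0LD2ThetaTorusEigenclass
open Summit.HodgeConjecture.HodgeConjecture.Cruxes.HLiu418.F0LD1ArchTorusHom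
open Summit.HodgeConjecture.HodgeConjecture.Cruxes.HLiu418.F0LD1ThetaClassTorusExtraction
open Summit.HodgeConjecture.HodgeConjecture.Cruxes.HLiu418.F0LD1ThetaClassHermiteSum
open Summit.HodgeConjecture.HodgeConjecture.Cruxes.HLiu418.F0LD1ThetaSliceTorusProjector (charProj_restrict_mem_closedSubrep exists_charRep_prod_prod_zpow)
open Summit.HodgeConjecture.HodgeConjecture.Cruxes.HLiu418.F0LD2PinnedArchSingleTransport (exists_archLocal_pin_adelicSingle_eq)


section Head

variable (L : Type) [Field L] [NumberField L] [IsCMField L] (N : ℕ) (H : Matrix (Fin N) (Fin N) L)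
  {n' : ℕ} (e₁ : Fin N × Fin 1 ≃ Fin n') (dV : Fin N → L) (hdV : ∀ i, IsCMField.complexConj L (dV i) = dV i)
  (hdV0 : ∀ i, dV i ≠ 0)
  (ιA : (adelicGroupData (↥(maximalRealSubfield L)) L (IsCMField.complexConj L) N H).Adelic →*
    ↥(UnitaryGroup.adelic (↥(maximalRealSubfield L)) L (IsCMField.complexConj L) N (Matrix.diagonal dV)))
  (hιA : Continuous ιA ∧ ∀ ⦃γ : (adelicGroupData (↥(maximalRealSubfield L)) L (IsCMField.complexConj L) N H).Adelic⦄,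
    γ ∈ (UnitaryGroup.toAdelic (↥(maximalRealSubfield L)) L (IsCMField.complexConj L) N H).range →
      ιA γ ∈ (UnitaryGroup.toAdelic (↥(maximalRealSubfield L)) L (IsCMField.complexConj L) N (Matrix.diagonal dV)).range)
  (μ : Literature.NumberTheory.Automorphic.IdeleClassGroup L →ₜ* Circle) (hμ : IsConjugateSymplectic L μ) (a : (↥(maximalRealSubfield L))ˣ)
  (hρ : HasThetaMajorants fun
      (p : ↥(UnitaryGroup.adelic (↥(maximalRealSubfield L)) L (IsCMField.complexConj L) N (Matrix.diagonal dV)) ×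
        ↥(UnitaryGroup.adelic (↥(maximalRealSubfield L)) L (IsCMField.complexConj L) 1 (JW (↥(maximalRealSubfield L)) L a)))
      (Φ : piSchwartzBruhat (↥(maximalRealSubfield L)) (Fin n')) =>
        pairRep (↥(maximalRealSubfield L)) L (IsCMField.complexConj L) N 1 e₁ (Matrix.diagonal dV) (JW (↥(maximalRealSubfield L)) L a)
          (chiSplittingLine L e₁ dV hdV hdV0 (toHeckeCharacter L μ) (isUnitary_toHeckeCharacter L μ)
            ((isOscillatorChar_toHeckeCharacter_iff μ).mpr hμ) (TW (↥(maximalRealSubfield L)) a)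
            (isUnit_det_TW (↥(maximalRealSubfield L)) a) (JW (↥(maximalRealSubfield L)) L a) (JW_eq (↥(maximalRealSubfield L)) L a))
          p Φ)
  [CompactSpace (↥(UnitaryGroup.adelic (↥(maximalRealSubfield L)) L (IsCMField.complexConj L) N (Matrix.diagonal dV)) ⧸
    (UnitaryGroup.toAdelic (↥(maximalRealSubfield L)) L (IsCMField.complexConj L) N (Matrix.diagonal dV)).range)]
  [MeasurableSpace (↥(UnitaryGroup.adelic (↥(maximalRealSubfield L)) L (IsCMField.complexConj L) 1 (JW (↥(maximalRealSubfield L)) L a)) ⧸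
    (UnitaryGroup.toAdelic (↥(maximalRealSubfield L)) L (IsCMField.complexConj L) 1 (JW (↥(maximalRealSubfield L)) L a)).range)]
  (μW : Measure (↥(UnitaryGroup.adelic (↥(maximalRealSubfield L)) L (IsCMField.complexConj L) 1 (JW (↥(maximalRealSubfield L)) L a)) ⧸
    (UnitaryGroup.toAdelic (↥(maximalRealSubfield L)) L (IsCMField.complexConj L) 1 (JW (↥(maximalRealSubfield L)) L a)).range))
  (f : C((↥(UnitaryGroup.adelic (↥(maximalRealSubfield L)) L (IsCMField.complexConj L) 1 (JW (↥(maximalRealSubfield L)) L a)) ⧸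
    (UnitaryGroup.toAdelic (↥(maximalRealSubfield L)) L (IsCMField.complexConj L) 1 (JW (↥(maximalRealSubfield L)) L a)).range), ℂ))
  [BorelSpace (↥(UnitaryGroup.adelic (↥(maximalRealSubfield L)) L (IsCMField.complexConj L) 1 (JW (↥(maximalRealSubfield L)) L a)) ⧸
    (UnitaryGroup.toAdelic (↥(maximalRealSubfield L)) L (IsCMField.complexConj L) 1 (JW (↥(maximalRealSubfield L)) L a)).range)]
  [IsFiniteMeasure μW]
  [CompactSpace (adelicGroupData (↥(maximalRealSubfield L)) L (IsCMField.complexConj L) N H).automorphicQuotient]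
  (ν : Measure (adelicGroupData (↥(maximalRealSubfield L)) L (IsCMField.complexConj L) N H).automorphicQuotient)
  [(adelicGroupData (↥(maximalRealSubfield L)) L (IsCMField.complexConj L) N H).IsAutomorphicMeasure ν]
  (t : L) (ht : t ≠ 0) (g : GL (Fin N) L)
  (hg : formCongr ((IsCMField.complexConj L : L ≃ₐ[↥(maximalRealSubfield L)] L) : L →+* L) g (t • H) = Matrix.diagonal dV)
  (hpin : ∀ k, ((ιA k : ↥(UnitaryGroup.adelic (↥(maximalRealSubfield L)) L (IsCMField.complexConj L) N (Matrix.diagonal dV))) :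
      GL (Fin N) (AdeleRing (𝓞 L) L)) =
    (toAdeleGL L g)⁻¹ * adelicVal (↥(maximalRealSubfield L)) L (IsCMField.complexConj L) N H k * toAdeleGL L g)

include hιA ht hg hpin

set_option maxHeartbeats 1600000 in
/-- **(P4) THE ι-STEP OF THE ARCHIMEDEAN LADDER** (the shape agreed with the HEAD owner, A-p16 (g35) a011).  At a real place `v₀` with a hyperbolic pair of
coordinates `(k₊, k₋)` (`hp : 0 < x_{v₀}(k₊)`, `hm : ¬ 0 < x_{v₀}(k₋)`) and boosts `u_s ∈ U(σ_{w₀} diag dV)(ℂ)` of that plane for every real parameter `s`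
(`hU`: the scaled-frame matrix `D (u_s ⊗ 1)^{e₁} D⁻¹` is `!![ch s, −i sh s; i sh s, ch s]` on `{k₊, k₋}`, `1` elsewhere), every closed `R`-invariant
`Q ⊆ L²([U(H)], ν)` containing `[θ_{h_β ⊗ Φ_f}]` contains `[θ_{h_{β + e_{(k₊,v₀)} + e_{(k₋,v₀)}} ⊗ Φ_f}]`, and contains `[θ_{h_{β − e_{(k₊,v₀)} − e_{(k₋,v₀)}} ⊗ Φ_f}]`
whenever `β(k₊,v₀) > 0` and `β(k₋,v₀) > 0` (★ `thetaClass_follandHermite_mem_of_boostCoeff_ne_zero` at the parameter supplied by ★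
`exists_piCoeff_add_reindex_hypOp_hermitePi_ne_zero` ∕ `…_sub_…`; the auxiliary data discharged as in ★ `F0LD1ThetaArchDefiniteTransitivity`).
[cite: Folland1989, §1.7 (1.82), §4.4 Thm. (4.37)] [cite: KashiwaraVergne1978, §6] [cite: Howe1989, §3] [cite: BrockerTomDieck1985, III (5.10)] -/
theorem iotaStep (v₀ : {v : InfinitePlace (↥(maximalRealSubfield L)) // v.IsReal}) (kp km : Fin n')
    (hp : 0 < signVec (cmPlaceOver L) (cmGramEntry L e₁ dV hdV (lineW L (TW (Fp L) a)) (complexConj_lineW L (TW (Fp L) a))) (imagUnit L) v₀ kp) (hm : ¬0 < signVec (cmPlaceOver L) (cmGramEntry L e₁ dV hdV (lineW L (TW (Fp L) a)) (complexConj_lineW L (TW (Fp L) a))) (imagUnit L) v₀ km)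
    (hU : ∀ s : ℝ, ∃ u : UnitaryGroup.archLocal L N (Matrix.diagonal dV) (cmPlaceOver L v₀), ∀ i i' : Fin n',
      ((sqrtAbs (signVec (cmPlaceOver L) (cmGramEntry L e₁ dV hdV (lineW L (TW (Fp L) a)) (complexConj_lineW L (TW (Fp L) a))) (imagUnit L) v₀) i : ℝ) : ℂ) *
          Matrix.reindex e₁ e₁
            ((((u : UnitaryGroup.archLocal L N (Matrix.diagonal dV) (cmPlaceOver L v₀)) : GL (Fin N) ℂ) : Matrix (Fin N) (Fin N) ℂ) ⊗ₖ
              (1 : Matrix (Fin 1) (Fin 1) ℂ)) i i' *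
          (((sqrtAbs (signVec (cmPlaceOver L) (cmGramEntry L e₁ dV hdV (lineW L (TW (Fp L) a)) (complexConj_lineW L (TW (Fp L) a))) (imagUnit L) v₀) i' : ℝ) : ℂ))⁻¹ =
        if i = kp then (if i' = kp then (Real.cosh s : ℂ) else if i' = km then -(Real.sinh s : ℂ) * Complex.I else 0)
        else if i = km then (if i' = kp then (Real.sinh s : ℂ) * Complex.I else if i' = km then (Real.cosh s : ℂ) else 0)
        else if i = i' then 1 else 0)
    (Q : ContRepresentation.ClosedSubrep ((adelicGroupData (↥(maximalRealSubfield L)) L (IsCMField.complexConj L) N H).rightRegular ν))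
    (β : (Fin n' × {v : InfinitePlace (↥(maximalRealSubfield L)) // v.IsReal}) →₀ ℕ) (Φf : FinSB (↥(maximalRealSubfield L)) (Fin n'))
    (hQ : MemLp.toLp _ (memLp_toQuotFun_lineThetaLift L N H e₁ dV hdV hdV0 ιA hιA μ hμ a hρ μW
          (piSchwartzBruhatEquiv (↥(maximalRealSubfield L)) (Fin n') (follandHermite (frameV L e₁ dV hdV hdV0 (lineW L (TW (Fp L) a)) (complexConj_lineW L (TW (Fp L) a)) (lineW_ne_zero L (TW (Fp L) a) (isUnit_det_TW (Fp L) a))) β ⊗ₜ Φf)) f ν 2) ∈ Q) :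
    MemLp.toLp _ (memLp_toQuotFun_lineThetaLift L N H e₁ dV hdV hdV0 ιA hιA μ hμ a hρ μW
          (piSchwartzBruhatEquiv (↥(maximalRealSubfield L)) (Fin n') (follandHermite (frameV L e₁ dV hdV hdV0 (lineW L (TW (Fp L) a)) (complexConj_lineW L (TW (Fp L) a)) (lineW_ne_zero L (TW (Fp L) a) (isUnit_det_TW (Fp L) a))) (β + (Finsupp.single (kp, v₀) 1 + Finsupp.single (km, v₀) 1)) ⊗ₜ Φf)) f ν 2) ∈ Q ∧
      (0 < β (kp, v₀) → 0 < β (km, v₀) →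
        MemLp.toLp _ (memLp_toQuotFun_lineThetaLift L N H e₁ dV hdV hdV0 ιA hιA μ hμ a hρ μW
          (piSchwartzBruhatEquiv (↥(maximalRealSubfield L)) (Fin n') (follandHermite (frameV L e₁ dV hdV hdV0 (lineW L (TW (Fp L) a)) (complexConj_lineW L (TW (Fp L) a)) (lineW_ne_zero L (TW (Fp L) a) (isUnit_det_TW (Fp L) a))) (β - (Finsupp.single (kp, v₀) 1 + Finsupp.single (km, v₀) 1)) ⊗ₜ Φf)) f ν 2) ∈ Q) := by
  -- the archimedean type of the splitting character
  have hτ : (toHeckeCharacter L μ).HasUnitaryArchType hμ.infinityType 0 :=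
    (hasUnitaryArchType_toHeckeCharacter_iff L μ _).2 hμ.hasInfinityType_infinityType
  have hodd : ∀ w, Odd (hμ.infinityType w) := hμ.odd_infinityType
  -- the archimedean torus hom through the pin, the Haar probability on `T_∞`, orbit continuity and unitarity of `R|_{T_∞}`
  obtain ⟨kT, hkTc, hkT, -, -⟩ := exists_continuous_archTorusHom L N H dV t ht g hg ιA hpin
  obtain ⟨mT, bT, μT, hprob, hinv⟩ := exists_borel_haarProbability L N
  letI : MeasurableSpace (({v : InfinitePlace (↥(maximalRealSubfield L)) // v.IsReal}) → Fin N → Circle) := mT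
  haveI : BorelSpace (({v : InfinitePlace (↥(maximalRealSubfield L)) // v.IsReal}) → Fin N → Circle) := bT
  haveI : IsProbabilityMeasure μT := hprob
  haveI : μT.IsMulLeftInvariant := hinv
  have hUc : ∀ w, Continuous fun z : (({v : InfinitePlace (↥(maximalRealSubfield L)) // v.IsReal}) → Fin N → Circle) =>
      (((adelicGroupData (↥(maximalRealSubfield L)) L (IsCMField.complexConj L) N H).rightRegular ν).restrict kT) z w := fun w => by
    simp only [ContRepresentation.restrict_apply]
    exact (AdelicGroupData.isStronglyContinuous_rightRegular_holds (adelicGroupData (↥(maximalRealSubfield L)) L (IsCMField.complexConj L) N H) ν w).comp hkTc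
  have hUu : ∀ (z : (({v : InfinitePlace (↥(maximalRealSubfield L)) // v.IsReal}) → Fin N → Circle))
      (w w' : (adelicGroupData (↥(maximalRealSubfield L)) L (IsCMField.complexConj L) N H).L2 ν),
      ⟪(((adelicGroupData (↥(maximalRealSubfield L)) L (IsCMField.complexConj L) N H).rightRegular ν).restrict kT) z w,
        (((adelicGroupData (↥(maximalRealSubfield L)) L (IsCMField.complexConj L) N H).rightRegular ν).restrict kT) z w'⟫_ℂ = ⟪w, w'⟫_ℂ :=
    fun z w w' => by
    rw [ContRepresentation.restrict_apply]
    exact (AdelicGroupData.isUnitary_rightRegular (adelicGroupData (↥(maximalRealSubfield L)) L (IsCMField.complexConj L) N H) ν).inner_map_map (kT z) w w'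
  -- the signs of the pair on the first copy of the doubled datum
  have Hp : 0 < signVec (cmPlaceOver L) (entryD L e₁ dV hdV (lineW L (TW (Fp L) a)) (complexConj_lineW L (TW (Fp L) a))) (imagUnit L) v₀ ((e₂ (n := n')) (Sum.inl kp)) := by
    rw [signVec_doubled_inl]; exact hp
  have Hm : ¬0 < signVec (cmPlaceOver L) (entryD L e₁ dV hdV (lineW L (TW (Fp L) a)) (complexConj_lineW L (TW (Fp L) a))) (imagUnit L) v₀ ((e₂ (n := n')) (Sum.inl km)) := by
    rw [signVec_doubled_inl]; exact hm
  -- ONE BOOST STEP for any target index `γ` and any parameter `s` with a non-zero boosted coefficient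
  have key : ∀ (γ : (Fin n' × {v : InfinitePlace (↥(maximalRealSubfield L)) // v.IsReal}) →₀ ℕ) (s : ℝ),
      piCoeff γ ((MpS.reindexEquiv (archIdx L n' (cmPlaceOver L) (cmGramEntry L e₁ dV hdV (lineW L (TW (Fp L) a)) (complexConj_lineW L (TW (Fp L) a))) (δ := imagUnit L)) (hypOpEquiv Unit Empty (⟨v₀, ⟨kp, hp⟩⟩ : Σ v, PosIdx (signVec (cmPlaceOver L) (cmGramEntry L e₁ dV hdV (lineW L (TW (Fp L) a)) (complexConj_lineW L (TW (Fp L) a))) (imagUnit L) v)) (⟨v₀, ⟨km, hm⟩⟩ : Σ v, NegIdx (signVec (cmPlaceOver L) (cmGramEntry L e₁ dV hdV (lineW L (TW (Fp L) a)) (complexConj_lineW L (TW (Fp L) a))) (imagUnit L) v)) s)) (hermitePi β)) ≠ 0 →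
      MemLp.toLp _ (memLp_toQuotFun_lineThetaLift L N H e₁ dV hdV hdV0 ιA hιA μ hμ a hρ μW
          (piSchwartzBruhatEquiv (↥(maximalRealSubfield L)) (Fin n') (follandHermite (frameV L e₁ dV hdV hdV0 (lineW L (TW (Fp L) a)) (complexConj_lineW L (TW (Fp L) a)) (lineW_ne_zero L (TW (Fp L) a) (isUnit_det_TW (Fp L) a))) γ ⊗ₜ Φf)) f ν 2) ∈ Q := fun γ s hne => by
    obtain ⟨u, hu⟩ := hU s
    obtain ⟨γ₀, hγ₀, -⟩ := exists_archLocal_pin_adelicSingle_eq L N H dV t ht g hg ιA hpin (cmPlaceOver L v₀) u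
    obtain ⟨κ, hκ, hκirr, hκu, hκc⟩ := exists_charRep_prod_prod_zpow
      (fun (v : {v : InfinitePlace (↥(maximalRealSubfield L)) // v.IsReal}) (p : Fin N) =>
        (if 0 < signVec (cmPlaceOver L) (cmGramEntry L e₁ dV hdV (lineW L (TW (Fp L) a)) (complexConj_lineW L (TW (Fp L) a))) (imagUnit L) v (e₁ (p, 0))
          then (hμ.infinityType (cmPlaceOver L v).1 + 1) / 2 + (γ (e₁ (p, 0), v) : ℤ)
          else (hμ.infinityType (cmPlaceOver L v).1 + 1) / 2 - 1 - (γ (e₁ (p, 0), v) : ℤ)))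
    haveI := hκirr
    exact thetaClass_follandHermite_mem_of_boostCoeff_ne_zero L N H e₁ dV hdV hdV0 ιA hιA μ hμ a hρ μW f ν v₀ hτ hodd u s kp km hp hm Hp Hm hu _ hγ₀
      β γ Φf hne kT hkT μT hκ hκu hκc hUc hUu Q hQ
  -- where the pair junction sends the two plane coordinates
  have hP : (archIdx L n' (cmPlaceOver L) (cmGramEntry L e₁ dV hdV (lineW L (TW (Fp L) a)) (complexConj_lineW L (TW (Fp L) a))) (δ := imagUnit L)).symm (idxP Unit Empty (⟨v₀, ⟨kp, hp⟩⟩ : Σ v, PosIdx (signVec (cmPlaceOver L) (cmGramEntry L e₁ dV hdV (lineW L (TW (Fp L) a)) (complexConj_lineW L (TW (Fp L) a))) (imagUnit L) v)) ()) = (kp, v₀) :=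
    ((Equiv.symm_apply_eq _).2
      ((archIdx_eq_idxP_iff L n' (cmPlaceOver L) (cmGramEntry L e₁ dV hdV (lineW L (TW (Fp L) a)) (complexConj_lineW L (TW (Fp L) a)))
        kp v₀ v₀ kp hp).2 ⟨rfl, rfl⟩).symm)
  have hQm : (archIdx L n' (cmPlaceOver L) (cmGramEntry L e₁ dV hdV (lineW L (TW (Fp L) a)) (complexConj_lineW L (TW (Fp L) a))) (δ := imagUnit L)).symm (idxQ Unit Empty (⟨v₀, ⟨km, hm⟩⟩ : Σ v, NegIdx (signVec (cmPlaceOver L) (cmGramEntry L e₁ dV hdV (lineW L (TW (Fp L) a)) (complexConj_lineW L (TW (Fp L) a))) (imagUnit L) v)) ()) = (km, v₀) :=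
    ((Equiv.symm_apply_eq _).2
      ((archIdx_eq_idxQ_iff L n' (cmPlaceOver L) (cmGramEntry L e₁ dV hdV (lineW L (TW (Fp L) a)) (complexConj_lineW L (TW (Fp L) a)))
        km v₀ v₀ km hm).2 ⟨rfl, rfl⟩).symm)
  constructor
  · -- up the ladder
    obtain ⟨s, hs⟩ := exists_piCoeff_add_reindex_hypOp_hermitePi_ne_zero Unit Empty
      (⟨v₀, ⟨kp, hp⟩⟩ : Σ v, PosIdx (signVec (cmPlaceOver L) (cmGramEntry L e₁ dV hdV (lineW L (TW (Fp L) a)) (complexConj_lineW L (TW (Fp L) a))) (imagUnit L) v)) (⟨v₀, ⟨km, hm⟩⟩ : Σ v, NegIdx (signVec (cmPlaceOver L) (cmGramEntry L e₁ dV hdV (lineW L (TW (Fp L) a)) (complexConj_lineW L (TW (Fp L) a))) (imagUnit L) v)) (archIdx L n' (cmPlaceOver L) (cmGramEntry L e₁ dV hdV (lineW L (TW (Fp L) a)) (complexConj_lineW L (TW (Fp L) a))) (δ := imagUnit L)) β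
    rw [hP, hQm] at hs
    refine key _ s ?_
    rw [MpS.reindexEquiv_apply, hypOpEquiv_apply]
    exact hs
  · -- down the ladder
    intro hk hk'
    obtain ⟨s, hs⟩ := exists_piCoeff_sub_reindex_hypOp_hermitePi_ne_zero Unit Empty
      (⟨v₀, ⟨kp, hp⟩⟩ : Σ v, PosIdx (signVec (cmPlaceOver L) (cmGramEntry L e₁ dV hdV (lineW L (TW (Fp L) a)) (complexConj_lineW L (TW (Fp L) a))) (imagUnit L) v)) (⟨v₀, ⟨km, hm⟩⟩ : Σ v, NegIdx (signVec (cmPlaceOver L) (cmGramEntry L e₁ dV hdV (lineW L (TW (Fp L) a)) (complexConj_lineW L (TW (Fp L) a))) (imagUnit L) v)) (archIdx L n' (cmPlaceOver L) (cmGramEntry L e₁ dV hdV (lineW L (TW (Fp L) a)) (complexConj_lineW L (TW (Fp L) a))) (δ := imagUnit L)) β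
      (by rw [hP]; exact hk) (by rw [hQm]; exact hk')
    rw [hP, hQm] at hs
    refine key _ s ?_
    rw [MpS.reindexEquiv_apply, hypOpEquiv_apply]
    exact hs

end Head

end Summit.HodgeConjecture.HodgeConjecture.Cruxes.HLiu418.F0LD1ThetaArchLadderIotaStep

end
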